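import Summits.AtomisticToContinuum.Crystallization.Theorems.ExcessDecayLiouvilleFarField
import Summits.AtomisticToContinuum.Crystallization.Theorems.ChargedEnergyGap.Negative.BlocksLocal

/-!
# Route `PhononSlackCertificates`, item `WindowOptimality` (stmt-AtomisticToContinuum-13962), parts I–II

## Part I: the cut

Helper lemmas for the cut-and-paste proof that a periodic window `P` of Lennard-Jones ground states
is a least-energy periodic configuration.  This part is about FINITE configurations only:

* `cut_lt`: for a Lennard-Jones ground state `y` of `N` particles in `ℝ³` and a set `W` of `M`
  particles with `0 < M < N`, the energy carried by `W`,
  `Σ_{i ∈ W} 𝓔ⁱ(y) + Σ_{i ∈ W} Σ_{j ∉ W} V(|yᵢ − yⱼ|) = Σ_{W×W} V + 2 Σ_{W×Wᶜ} V`,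
  is `< 2 E(M)`: by strict binding `E(N) < E(M) + E(N − M)` (Blanc–Lewin 2015, (6), proved in
  `LennardJonesClusters`) and `E(N − M) ≤` the energy of the particles outside `W`.
* `neg_le_sum_lennardJones_of_far`: the interaction of one particle of a `δ`-separated configuration
  with any set of particles at distance `≥ ρ ≥ δ` is `≥ −(1/6)·1024/(δ³ρ³)` (the `r⁻⁶` tail over a
  separated set, `ExcessDecayLiouville.sum_inv_pow_le_of_separated`).
* two pointwise facts on `V_LJ`: `V_LJ(r) ≤ r⁻⁶/12` for `r ≥ 1`, and continuity away from `0` in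
  the quantitative form used by the matching argument.

All `[folklore]`; nothing here closes the item (part II below: the periodic side; parts III–IV in
`PhononSlackCertificatesWindowOptimalityMatch.lean`, `PhononSlackCertificatesWindowOptimality.lean`).
-/

noncomputable section

namespace Summit.AtomisticToContinuum.Crystallization.Theorems.PhononSlackWindowOptimality

open Literature.MathematicalPhysics.StatisticalMechanics
open Summit.AtomisticToContinuum.Crystallization.Theorems.ChargedEnergyGapNegative
open scoped BigOperators Topology
open Filter

/-! ### The cut inequality -/

/-- For `V_LJ` (`V 0 = 0`) the site energy is the full row sum, diagonal included. [folklore] -/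
theorem siteEnergy_eq_sum_univ {N : ℕ} (y : Fin N → E3) (i : Fin N) :
    siteEnergy lennardJones y i = ∑ j, lennardJones (dist (y i) (y j)) := by
  unfold siteEnergy
  exact Finset.sum_erase Finset.univ (by rw [dist_self, lennardJones_zero])

/-- The energy carried by a set of particles `W`: site energies plus once more the cross terms,
`Σ_{i ∈ W} 𝓔ⁱ + Σ_{i ∈ W} Σ_{j ∉ W} V = Σ_{W×W} V + 2·Σ_{W×Wᶜ} V`. [folklore] -/
theorem cut_eq {N : ℕ} (y : Fin N → E3) (W : Finset (Fin N)) :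
    ∑ i ∈ W, siteEnergy lennardJones y i + ∑ i ∈ W, ∑ j ∈ Wᶜ, lennardJones (dist (y i) (y j)) =
      ∑ i ∈ W, ∑ j ∈ W, lennardJones (dist (y i) (y j)) +
        2 * ∑ i ∈ W, ∑ j ∈ Wᶜ, lennardJones (dist (y i) (y j)) := by
  have h : ∑ i ∈ W, siteEnergy lennardJones y i =
      ∑ i ∈ W, ∑ j ∈ W, lennardJones (dist (y i) (y j)) +
        ∑ i ∈ W, ∑ j ∈ Wᶜ, lennardJones (dist (y i) (y j)) := by
    rw [← Finset.sum_add_distrib]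
    refine Finset.sum_congr rfl fun i _ => ?_
    rw [siteEnergy_eq_sum_univ]
    exact (Finset.sum_add_sum_compl W _).symm
  rw [h]
  ring

/-- **The cut inequality.** In a Lennard-Jones ground state of `N` particles in `ℝ³`, a set `W` of
`M` particles with `0 < M < N` carries energy `< 2 E(M)`:
`Σ_{i∈W} 𝓔ⁱ + Σ_{i∈W} Σ_{j∉W} V(|yᵢ − yⱼ|) < 2 E(M)`.  Proof: `2E(N) = Σ_{W×W} + Σ_{Wᶜ×Wᶜ} +
2Σ_{W×Wᶜ}`, `Σ_{Wᶜ×Wᶜ} ≥ 2E(N − M)` and strict binding `E(N) < E(M) + E(N − M)`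
(Blanc–Lewin 2015, (6)). [folklore] -/
theorem cut_lt {N : ℕ} {y : Fin N → E3} (hy : IsGroundState lennardJones y) (W : Finset (Fin N))
    (hW : 0 < W.card) (hWc : 0 < Wᶜ.card) :
    ∑ i ∈ W, siteEnergy lennardJones y i + ∑ i ∈ W, ∑ j ∈ Wᶜ, lennardJones (dist (y i) (y j)) <
      2 * groundStateEnergy lennardJones 3 W.card := by
  obtain ⟨z, hz⟩ := LennardJonesGroundStatesExist_holds W.card
  obtain ⟨w, hw⟩ := LennardJonesGroundStatesExist_holds Wᶜ.card
  have hlt := groundStateEnergy_add_lt (d := 3) (by norm_num) hW hWc hz hw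
  have hN : W.card + Wᶜ.card = N := by rw [Finset.card_add_card_compl, Fintype.card_fin]
  rw [hN] at hlt
  have h2 := two_mul_interactionEnergy_eq_sum_sum lennardJones lennardJones_zero y
  rw [sum_sum_eq_add_compl _ W, hy.2] at h2
  have hWc2 := two_mul_groundStateEnergy_card_le lennardJones lennardJones_zero
    neg_one_div_le_lennardJones hy.1 Wᶜ
  have hsymm : ∑ i ∈ Wᶜ, ∑ k ∈ W, lennardJones (dist (y i) (y k)) =
      ∑ i ∈ W, ∑ k ∈ Wᶜ, lennardJones (dist (y i) (y k)) := by
    rw [Finset.sum_comm]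
    exact Finset.sum_congr rfl fun _ _ => Finset.sum_congr rfl fun _ _ => by rw [dist_comm]
  rw [cut_eq]
  linarith

/-! ### The `r⁻⁶` tail of one particle over a separated set -/

/-- A `δ`-separated configuration (`δ > 0`) is injective. [folklore] -/
theorem injective_of_separated {N : ℕ} {y : Fin N → E3} {δ : ℝ} (hδ : 0 < δ)
    (hsep : ∀ i j, i ≠ j → δ ≤ dist (y i) (y j)) : Function.Injective y := by
  intro i j hij
  by_contra hne
  have := hsep i j hne
  rw [hij, dist_self] at this
  exact absurd this (not_le.2 hδ)

/-- **Tail bound.** In a `δ`-separated configuration of `ℝ³`, the Lennard-Jones interaction of the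
particle `i` with any set `S` of particles all at distance `≥ ρ ≥ δ` from it is
`≥ −(1/6)·1024/(δ³ρ³)` (`V_LJ(r) ≥ −r⁻⁶/6` and the dyadic-shell packing bound
`Σ_{|a−p| ≥ ρ} |a − p|⁻⁶ ≤ 1024/(δ³ρ³)`). [folklore] -/
theorem neg_le_sum_lennardJones_of_far {N : ℕ} {y : Fin N → E3} {δ ρ : ℝ} (hδ : 0 < δ)
    (hδρ : δ ≤ ρ) (hsep : ∀ i j, i ≠ j → δ ≤ dist (y i) (y j)) (i : Fin N) (S : Finset (Fin N))
    (hfar : ∀ j ∈ S, ρ ≤ dist (y i) (y j)) :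
    -(1 / 6 * (1024 / (δ ^ 3 * ρ ^ 3))) ≤ ∑ j ∈ S, lennardJones (dist (y i) (y j)) := by
  classical
  have hinj := injective_of_separated hδ hsep
  have hρ : 0 < ρ := hδ.trans_le hδρ
  have hterm : ∀ j ∈ S,
      -(1 / 6 * (dist (y i) (y j))⁻¹ ^ 6) ≤ lennardJones (dist (y i) (y j)) := fun j hj =>
    neg_le_lennardJones_of_le (hρ.trans_le (hfar j hj)) le_rfl
  have hsum : ∑ j ∈ S, (dist (y i) (y j))⁻¹ ^ 6 ≤ 1024 / (δ ^ 3 * ρ ^ 3) := by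
    have h := ExcessDecayLiouville.sum_inv_pow_le_of_separated (S.image y) (y i) (k := 3)
      (by norm_num) hδ hδρ ?_ ?_
    · rw [Finset.sum_image fun a _ b _ h => hinj h] at h
      refine le_of_eq_of_le (Finset.sum_congr rfl fun j _ => ?_) h
      rw [dist_comm]
    · intro a ha b hb hab
      obtain ⟨j, -, rfl⟩ := Finset.mem_image.1 ha
      obtain ⟨l, -, rfl⟩ := Finset.mem_image.1 hb
      exact hsep j l fun h => hab (by rw [h])
    · intro a ha
      obtain ⟨j, hj, rfl⟩ := Finset.mem_image.1 ha
      rw [dist_comm]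
      exact hfar j hj
  calc -(1 / 6 * (1024 / (δ ^ 3 * ρ ^ 3)))
      ≤ -(1 / 6 * ∑ j ∈ S, (dist (y i) (y j))⁻¹ ^ 6) := by linarith
    _ = ∑ j ∈ S, -(1 / 6 * (dist (y i) (y j))⁻¹ ^ 6) := by
        rw [Finset.mul_sum, Finset.sum_neg_distrib]
    _ ≤ ∑ j ∈ S, lennardJones (dist (y i) (y j)) := Finset.sum_le_sum hterm

/-- Each Lennard-Jones pair term is `≥ −1/12`, so a sum over `S` is `≥ −#S/12`. [folklore] -/
theorem neg_card_le_sum_lennardJones {N : ℕ} (y : Fin N → E3) (i : Fin N) (S : Finset (Fin N)) :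
    -((S.card : ℝ) / 12) ≤ ∑ j ∈ S, lennardJones (dist (y i) (y j)) := by
  have h := Finset.sum_le_sum fun j (_ : j ∈ S) => neg_one_div_le_lennardJones (dist (y i) (y j))
  rw [Finset.sum_const, nsmul_eq_mul] at h
  linarith

/-! ### Two pointwise facts on the Lennard-Jones potential -/

/-- Beyond the equilibrium distance the repulsion is dominated by the sixth power:
`V_LJ(r) ≤ r⁻⁶/12` for `r ≥ 1`. [folklore] -/
theorem lennardJones_le_six {r : ℝ} (hr : 1 ≤ r) : lennardJones r ≤ 1 / 12 * Blocks.six r := by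
  unfold lennardJones Blocks.six
  have h0 : 0 ≤ r⁻¹ := inv_nonneg.2 (by linarith)
  have h1 : r⁻¹ ≤ 1 := inv_le_one_of_one_le₀ hr
  have h12 : (r⁻¹) ^ 12 ≤ (r⁻¹) ^ 6 := pow_le_pow_of_le_one h0 h1 (by norm_num)
  nlinarith [pow_nonneg h0 6]

/-- **Continuity of `V_LJ` away from `0`, quantitatively**: for `d₀ ≠ 0` and `ω > 0`, for all
sufficiently small `ε > 0`, every `r` with `|r − d₀| ≤ 2ε` has `V_LJ(d₀) − ω ≤ V_LJ(r)`. [folklore] -/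
theorem eventually_sub_le_lennardJones {d₀ ω : ℝ} (hd₀ : d₀ ≠ 0) (hω : 0 < ω) :
    ∀ᶠ ε in 𝓝[>] (0 : ℝ), ∀ r : ℝ, |r - d₀| ≤ 2 * ε → lennardJones d₀ - ω ≤ lennardJones r := by
  have hc : ContinuousAt lennardJones d₀ :=
    continuousOn_lennardJones.continuousAt (isOpen_compl_singleton.mem_nhds hd₀)
  obtain ⟨γ, hγ, hγ'⟩ := Metric.continuousAt_iff.1 hc ω hω
  have hev : ∀ᶠ ε in 𝓝[>] (0 : ℝ), ε < γ / 2 :=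
    (eventually_lt_nhds (half_pos hγ)).filter_mono nhdsWithin_le_nhds
  filter_upwards [hev] with ε hε r hr
  have hlt : dist r d₀ < γ := by
    rw [Real.dist_eq]
    linarith
  have h := hγ' hlt
  rw [Real.dist_eq] at h
  have := (abs_lt.1 h).1
  linarith

end Summit.AtomisticToContinuum.Crystallization.Theorems.PhononSlackWindowOptimality

end

/-!
## Part II: the periodic side

Facts about a periodic configuration `P` of `ℝ³` used by the cut-and-paste argument, phrased
WITHOUT new definitions (finite neighbourhoods are passed as finsets `F` characterised by
`q ∈ F ↔ dist p q < L`):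

* `exists_sep`: `P.points` is uniformly discrete (a positive lower bound `s_P` for the distances of
  distinct points: the least nearest-neighbour distance over the motif, by periodicity);
* `exists_nearFinset`: the points of `P` within distance `< L` of a point form a finite set;
* `siteSum_le_near_add_farSix`: for `L ≥ 1` the lattice sum `Σ_{q ≠ p} V_LJ(|p − q|)` is at most its
  part over `dist < L` plus `(1/12)·Σ_{dist ≥ L} |p − q|⁻⁶` (`V_LJ ≤ r⁻⁶/12` beyond `r = 1`);
* `near_card_le_of_eq_add`, `exists_near_card_le`: the number of points within `L` of a point of
  `P` is bounded uniformly (translation invariance + finitely many motif classes);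
* `exists_norm_bpt_le`: the blocks `Blocks.bpt P k` of part `ChargedEnergyGap/Negative/Blocks*` are
  bounded sets;
* `sum_near_ge_block`: summing the near parts over a block recovers `2·#F·k³·e(P)` up to the far
  sixth-power sums: `Σ_u Σ_{near u} V ≥ k³·(2#F e(P)) − (1/12)·k³·farSum P L`.

All `[folklore]`; helper file (`--supports`), nothing here closes the item.
-/

noncomputable section

namespace Summit.AtomisticToContinuum.Crystallization.Theorems.PhononSlackWindowOptimality

open Literature.MathematicalPhysics.StatisticalMechanics
open Literature.Geometry.DiscreteGeometry
open Summit.AtomisticToContinuum.Crystallization.Theorems.ChargedEnergyGapNegative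
open scoped BigOperators Topology
open Filter

variable (P : PeriodicConfiguration 3)

/-! ### Uniform discreteness of a periodic configuration -/

/-- **A periodic configuration is uniformly discrete**: there is `s > 0` with `dist p q ≥ s` for
all distinct points `p, q` of `P` (the least nearest-neighbour distance of a motif point; every
point is a lattice translate of a motif point). [folklore] -/
theorem exists_sep : ∃ s : ℝ, 0 < s ∧ ∀ p ∈ P.points, ∀ q ∈ P.points, p ≠ q → s ≤ dist p q := by
  classical
  obtain ⟨x₀, -, hmin⟩ := P.motif.attach.exists_min_image
    (fun x : {x // x ∈ P.motif} =>
      nearestDist (Blocks.ptConfig P) ⟨x.1, P.mem_points_of_mem_motif x.2⟩)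
    (Finset.attach_nonempty_iff.2 P.motif_nonempty)
  refine ⟨nearestDist (Blocks.ptConfig P) ⟨x₀.1, P.mem_points_of_mem_motif x₀.2⟩,
    Blocks.nearestDist_pt_pos P _, fun p hp q hq hpq => ?_⟩
  obtain ⟨x, hx, g, hg, hpx⟩ := hp
  have hp' : p ∈ P.points := ⟨x, hx, g, hg, hpx⟩
  have hpt : (⟨p, hp'⟩ : P.points) = Blocks.transl P hg ⟨x, P.mem_points_of_mem_motif hx⟩ :=
    Subtype.ext hpx
  have hqp : (⟨q, hq⟩ : P.points) ≠ ⟨p, hp'⟩ := fun h => hpq (congrArg Subtype.val h).symm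
  have h1 := hmin ⟨x, hx⟩ (Finset.mem_attach _ _)
  have h2 : nearestDist (Blocks.ptConfig P) ⟨p, hp'⟩ =
      nearestDist (Blocks.ptConfig P) ⟨x, P.mem_points_of_mem_motif hx⟩ := by
    rw [hpt, Blocks.nearestDist_transl]
  have h3 := nearestDist_le_dist (Blocks.ptConfig P) hqp
  have e : dist (Blocks.ptConfig P ⟨p, hp'⟩) (Blocks.ptConfig P ⟨q, hq⟩) = dist p q := rfl
  rw [e] at h3
  calc nearestDist (Blocks.ptConfig P) ⟨x₀.1, P.mem_points_of_mem_motif x₀.2⟩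
      ≤ nearestDist (Blocks.ptConfig P) ⟨x, P.mem_points_of_mem_motif hx⟩ := h1
    _ = nearestDist (Blocks.ptConfig P) ⟨p, hp'⟩ := h2.symm
    _ ≤ dist p q := h3

/-! ### Finite neighbourhoods -/

/-- The points of `P` other than `p` within distance `< L` of `p` form a finite set (local
finiteness of periodic configurations). [folklore] -/
theorem exists_nearFinset (p : E3) (L : ℝ) :
    ∃ F : Finset {q : E3 // q ∈ P.points ∧ q ≠ p}, ∀ q, q ∈ F ↔ dist p q.1 < L := by
  classical
  have hfin := P.finite_inter_points (Metric.isBounded_ball (x := p) (r := L))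
  refine ⟨hfin.toFinset.subtype fun q => q ∈ P.points ∧ q ≠ p, fun q => ?_⟩
  rw [Finset.mem_subtype, Set.Finite.mem_toFinset, Set.mem_inter_iff, Metric.mem_ball, dist_comm]
  exact ⟨fun h => h.1, fun h => ⟨h, q.2.1⟩⟩

/-- **Near/far splitting of a Lennard-Jones lattice sum.** For `L ≥ 1`,
`Σ_{q ≠ p} V_LJ(|p − q|) ≤ Σ_{q ≠ p, |p−q| < L} V_LJ(|p − q|) + (1/12)·Σ_{|p−q| ≥ L} |p − q|⁻⁶`.
[folklore] -/
theorem siteSum_le_near_add_farSix (p : E3) {L : ℝ} (hL : 1 ≤ L)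
    (F : Finset {q : E3 // q ∈ P.points ∧ q ≠ p}) (hF : ∀ q, q ∈ F ↔ dist p q.1 < L) :
    Blocks.siteSum P lennardJones p ≤
      ∑ q ∈ F, lennardJones (dist p q.1) + 1 / 12 * Blocks.farSix P p L := by
  have hs := P.summable_lennardJones_dist_three p
  unfold Blocks.siteSum
  rw [← hs.sum_add_tsum_compl (s := F)]
  have hfarq : ∀ q : {q : E3 // q ∈ P.points ∧ q ≠ p}, q ∈ ((F : Set _)ᶜ : Set _) →
      L ≤ dist p q.1 := by
    intro q hq
    by_contra hlt
    exact hq ((hF q).2 (not_le.1 hlt))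
  have h1 : ∑' q : ((F : Set {q : E3 // q ∈ P.points ∧ q ≠ p})ᶜ : Set _),
      lennardJones (dist p q.1.1) ≤
        ∑' q : ((F : Set {q : E3 // q ∈ P.points ∧ q ≠ p})ᶜ : Set _),
          1 / 12 * Blocks.six (dist p q.1.1) := by
    refine Summable.tsum_le_tsum (fun q => lennardJones_le_six (hL.trans (hfarq q.1 q.2))) ?_ ?_
    · exact hs.subtype _
    · exact ((Blocks.summable_six P p).mul_left (1 / 12)).subtype _
  have h2 : ∑' q : ((F : Set {q : E3 // q ∈ P.points ∧ q ≠ p})ᶜ : Set _),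
      1 / 12 * Blocks.six (dist p q.1.1) =
        1 / 12 * ∑' q : ((F : Set {q : E3 // q ∈ P.points ∧ q ≠ p})ᶜ : Set _),
          Blocks.six (dist p q.1.1) := tsum_mul_left
  have h3 : ∑' q : ((F : Set {q : E3 // q ∈ P.points ∧ q ≠ p})ᶜ : Set _),
      Blocks.six (dist p q.1.1) ≤ Blocks.farSix P p L := by
    unfold Blocks.farSix
    exact Blocks.tsum_subtype_mono (Blocks.summable_six P p) (fun _ => Blocks.six_nonneg _) hfarq
  have h4 : 1 / 12 * ∑' q : ((F : Set {q : E3 // q ∈ P.points ∧ q ≠ p})ᶜ : Set _),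
      Blocks.six (dist p q.1.1) ≤ 1 / 12 * Blocks.farSix P p L :=
    mul_le_mul_of_nonneg_left h3 (by norm_num)
  linarith

/-! ### Uniform bound on the number of near points -/

/-- Translating by a period does not change the number of near points: the near set at `x + g`
injects into the near set at `x`. [folklore] -/
theorem near_card_le_of_eq_add {x g : E3} (hg : g ∈ P.lattice) {L : ℝ}
    (F : Finset {q : E3 // q ∈ P.points ∧ q ≠ x + g}) (G : Finset {q : E3 // q ∈ P.points ∧ q ≠ x})
    (hF : ∀ q, q ∈ F ↔ dist (x + g) q.1 < L) (hG : ∀ q, q ∈ G ↔ dist x q.1 < L) :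
    F.card ≤ G.card := by
  refine Finset.card_le_card_of_injOn (fun q => (Blocks.shiftEquiv P hg x).symm q) ?_ ?_
  · intro q hq
    rw [Finset.mem_coe, hG]
    have h := (hF q).1 (Finset.mem_coe.1 hq)
    have e : ((Blocks.shiftEquiv P hg x).symm q).1 = q.1 - g := rfl
    rw [e]
    calc dist x (q.1 - g) = dist (x + g) (q.1 - g + g) := (dist_add_right _ _ _).symm
      _ = dist (x + g) q.1 := by rw [sub_add_cancel]
      _ < L := h
  · intro q _ q' _ h
    exact (Blocks.shiftEquiv P hg x).symm.injective h

/-- **Uniformly in the block size and the block point, the number of points of `P` within `L` of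
a block point is bounded** (by the total over the motif). [folklore] -/
theorem exists_near_card_le (L : ℝ) : ∃ n : ℕ, ∀ (k : ℕ) (u : Blocks.BIdx P k)
    (F : Finset {q : E3 // q ∈ P.points ∧ q ≠ Blocks.bpt P k u}),
      (∀ q, q ∈ F ↔ dist (Blocks.bpt P k u) q.1 < L) → F.card ≤ n := by
  classical
  choose G hG using fun x : E3 => exists_nearFinset P x L
  refine ⟨∑ x ∈ P.motif, (G x).card, fun k u F hF => ?_⟩
  have hle : F.card ≤ (G u.1).card :=
    near_card_le_of_eq_add P (Blocks.latVec_mem P (Blocks.coords k u.2)) F (G u.1) hF (hG u.1)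
  exact hle.trans (Finset.single_le_sum (f := fun x => (G x).card) (fun _ _ => Nat.zero_le _) u.1.2)

/-! ### Blocks are bounded -/

/-- The block `{bpt u}` is a bounded set: `‖bpt u‖ ≤ B` for all block indices `u`. [folklore] -/
theorem exists_norm_bpt_le (k : ℕ) : ∃ B : ℝ, 0 ≤ B ∧ ∀ u : Blocks.BIdx P k, ‖Blocks.bpt P k u‖ ≤ B :=
  ⟨∑ u : Blocks.BIdx P k, ‖Blocks.bpt P k u‖, Finset.sum_nonneg fun _ _ => norm_nonneg _, fun u =>
    Finset.single_le_sum (f := fun u => ‖Blocks.bpt P k u‖) (fun _ _ => norm_nonneg _)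
      (Finset.mem_univ u)⟩

/-! ### Summing the near parts over a block -/

/-- Sums over block indices of a function of the motif point: `Σ_u f(u.1) = k³ · Σ_{x ∈ F} f x`.
[folklore] -/
theorem sum_BIdx_fst (k : ℕ) (f : E3 → ℝ) :
    ∑ u : Blocks.BIdx P k, f u.1 = (k : ℝ) ^ 3 * ∑ x ∈ P.motif, f x := by
  rw [Fintype.sum_prod_type]
  simp only [Finset.sum_const, Finset.card_univ, Fintype.card_fun, Fintype.card_fin, nsmul_eq_mul]
  rw [← Finset.mul_sum, Finset.sum_coe_sort P.motif f]
  push_cast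
  ring

/-- **The near parts over a block sum to the bulk energy up to far tails**: for `L ≥ 1` and near
finsets `F u` (radius `L`) at the block points,
`k³·(2·#F·e(P)) − (1/12)·k³·farSum P L ≤ Σ_u Σ_{q ∈ F u} V_LJ(|bpt u − q|)`. [folklore] -/
theorem sum_near_ge_block (k : ℕ) {L : ℝ} (hL : 1 ≤ L)
    (F : ∀ u : Blocks.BIdx P k, Finset {q : E3 // q ∈ P.points ∧ q ≠ Blocks.bpt P k u})
    (hF : ∀ u q, q ∈ F u ↔ dist (Blocks.bpt P k u) q.1 < L) :
    (k : ℝ) ^ 3 * (2 * P.motif.card * P.energyPerParticle lennardJones) -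
        1 / 12 * ((k : ℝ) ^ 3 * Blocks.farSum P L) ≤
      ∑ u : Blocks.BIdx P k, ∑ q ∈ F u, lennardJones (dist (Blocks.bpt P k u) q.1) := by
  have hpt : ∀ u : Blocks.BIdx P k,
      Blocks.siteSum P lennardJones u.1 - 1 / 12 * Blocks.farSix P u.1 L ≤
        ∑ q ∈ F u, lennardJones (dist (Blocks.bpt P k u) q.1) := by
    intro u
    have h := siteSum_le_near_add_farSix P (Blocks.bpt P k u) hL (F u) (hF u)
    rw [Blocks.siteSum_bpt] at h
    have e : Blocks.farSix P (Blocks.bpt P k u) L = Blocks.farSix P u.1 L :=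
      Blocks.farSix_add P (Blocks.latVec_mem P (Blocks.coords k u.2)) _ L
    rw [e] at h
    linarith
  have hsum := Finset.sum_le_sum fun u (_ : u ∈ Finset.univ) => hpt u
  rw [Finset.sum_sub_distrib, sum_BIdx_fst P k (Blocks.siteSum P lennardJones),
    Blocks.sum_siteSum_eq, ← Finset.mul_sum,
    sum_BIdx_fst P k (fun x => Blocks.farSix P x L)] at hsum
  unfold Blocks.farSum
  exact hsum

end Summit.AtomisticToContinuum.Crystallization.Theorems.PhononSlackWindowOptimality

end
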